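import Literature.NumberTheory.EllipticCurves.ShaPrimaryModDivisibleSquare
import HarnessLib

/-!
# Route `GenusKolyvaginAtTwo`, crux `RankOneShaCellBSDTwo` (stmt-BirchSwinnertonDyer-27477): `#Ш(E/K)[2^∞]` IS A SQUARE, granting Cassels–Tate
# (the pen's LINE 41 stub SQ `ShaTwoPrimarySquare`, with its PRINT binder made explicit) — LEAD bsd-line-gk2-p1 g32

Seat `bsd-line-gk2-p1` g32 (LEAD lineage, cell `bsd-f1-sign2`).  THEOREMS ONLY, standard axioms, no `sorry`.  **BSD is NOT proved; the Ш-cell 27477 and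
every research stub stay OPEN; nothing is closed (LINE 41 is unregistered).**

The pen's LINE 41 «restriction_rigidity» (v1.4+) refunds the one-bit loss of Kolyvagin's annihilator at `2` by the SQUARENESS of `#Ш(W_K)[2^∞]`
(stub SQ `ShaTwoPrimarySquare : ∀ K E, IsSquare (Nat.card (Ш(E/K)[2^∞]))`).  The tree holds Dokchitser–Dokchitser's sentence «the `p`-primary parts
of `Ш/Ш_div` have square order by Cassels–Tate pairing» GRANTING the pairing as the named PRINT fact `WeierstrassCurve.exists_casselsTate_pairing`
(`isSquare_natCard_quot_divisibleElements_primaryComponent_sha`).  Here: the `Nat.card` form for the `p`-primary part itself — if `Ш[p^∞]` is finite its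
divisible part is trivial (`divisibleElements_eq_bot_of_finite`), if infinite `Nat.card = 0 = 0²` — so ★ `isSquare_natCard_primaryComponent_sha_of_casselsTate`
and `shaTwoPrimarySquare_of_casselsTate : (∀ K, exists_casselsTate_pairing) → <SQ text verbatim>`.  RIDER (as for RIG): SQ as typed (no Cassels–Tate
binder) is closable by name only once `exists_casselsTate_pairing_holds` lands; with the binder prepended it is this file's last theorem.

References: [DokchitserDokchitserAnnals2010] Thm. 4.3, Cor. 4.5 (proof, p. 18); [SilvermanAEC2009] Thm. X.4.14, Ex. 10.20; Cassels 1962 (IV); Milne ADT I.6.13(a).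
-/

set_option autoImplicit false
set_option linter.dupNamespace false -- `Summit.<P>.<Sub>` repeats `BirchSwinnertonDyer` (D-0017)

noncomputable section

open scoped Classical

universe u

namespace Summit.BirchSwinnertonDyer.BirchSwinnertonDyer.Theorems.GenusExact.ShaCell.ShaSquare

open Literature.NumberTheory.EllipticCurves WeierstrassCurve

/-- ★ **`#Ш(E/K)[p^∞]` is a perfect square (as a `Nat.card`), granting the Cassels–Tate pairing** — any number field `K`, any prime `p`: if `Ш[p^∞]` is
finite its divisible part is `0` and Dokchitser–Dokchitser's «`#(Ш[p^∞]/Ш[p^∞]_div)` is a square» applies verbatim; if it is infinite, `Nat.card = 0 = 0·0`.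
CONDITIONAL on `exists_casselsTate_pairing` (displayed). [cite: DokchitserDokchitserAnnals2010, Cor. 4.5 (proof, p. 18)] [cite: SilvermanAEC2009, Thm. X.4.14] -/
theorem isSquare_natCard_primaryComponent_sha_of_casselsTate {K : Type u} [Field K] [NumberField K]
    (hCT : exists_casselsTate_pairing (K := K)) (E : WeierstrassCurve K) [E.IsElliptic] (p : ℕ) [Fact p.Prime] :
    IsSquare (Nat.card (AddCommGroup.primaryComponent E.sha p)) := by
  by_cases hfin : Finite (AddCommGroup.primaryComponent E.sha p)
  · have hsq := isSquare_natCard_quot_divisibleElements_primaryComponent_sha E p hCT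
    have hbot := divisibleElements_eq_bot_of_finite (AddCommGroup.primaryComponent E.sha p)
    have e : (AddCommGroup.primaryComponent E.sha p ⧸ AddSubgroup.divisibleElements (AddCommGroup.primaryComponent E.sha p)) ≃+
        AddCommGroup.primaryComponent E.sha p :=
      (QuotientAddGroup.quotientAddEquivOfEq hbot).trans QuotientAddGroup.quotientBot
    rwa [Nat.card_congr e.toEquiv] at hsq
  · rw [not_finite_iff_infinite] at hfin
    rw [Nat.card_eq_zero_of_infinite]
    exact ⟨0, rfl⟩

/-- **The pen's LINE 41 stub SQ `ShaTwoPrimarySquare` — VERBATIM text, with the Cassels–Tate PRINT fact PREPENDED** (`p = 2`, every number field, every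
elliptic curve; void-true when `Ш[2^∞]` is infinite).  CONDITIONAL; closes nothing. [cite: DokchitserDokchitserAnnals2010, Cor. 4.5 (proof, p. 18)] -/
theorem shaTwoPrimarySquare_of_casselsTate
    (hCT : ∀ (K : Type) [Field K] [NumberField K], exists_casselsTate_pairing (K := K)) :
    ∀ (K : Type) [Field K] [NumberField K] (E : WeierstrassCurve K) [E.IsElliptic],
      IsSquare (Nat.card (AddCommGroup.primaryComponent E.sha 2)) :=
  fun K _ _ E _ ↦ isSquare_natCard_primaryComponent_sha_of_casselsTate (hCT K) E 2

end Summit.BirchSwinnertonDyer.BirchSwinnertonDyer.Theorems.GenusExact.ShaCell.ShaSquare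

end
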